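import Mathlib
import Summits.ValiantsHypothesis.ValiantsHypothesis.Theorems.RigidityForcesSymmetryRankRigidMinimalReprLaplaceFiveSectorSplitDefs
import Summits.ValiantsHypothesis.ValiantsHypothesis.Theorems.RigidityForcesSymmetryRankRigidMinimalReprLaplaceFiveThreeSplitTypes
import Summits.ValiantsHypothesis.ValiantsHypothesis.Theorems.RigidityForcesSymmetryRankRigidMinimalReprLaplaceFiveThreeSplit

/-!
# ValiantsHypothesis / RigidityForcesSymmetry — crux `LaplaceOptimalFive` (stmt-ValiantsHypothesis-24813), crux idea
`young-shadow` (K1): FOUR-SPLIT SEPARATION for the three RIGID four-edge supports, at normalized slots.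

Four distinct pair splits of `Fin 5` form one of six graphs: the path `P₅`, the paw, the chair (rigid: no Young-invariant
relations, card `young-shadow.md` (2)) and the slack `K₁,₄`, `C₄`, `K₃ ⊔ K₂`.  For the three rigid types one shadow inherits,
from the full symmetry of the sum, a transposition lying in the Young groups of ALL THREE other splits, which connects its own
swaps; that shadow is fully symmetric and the remaining three separate by ✓ `LaplaceFiveThreeSplit.threeSplit_separation`.
Representatives: `P₅ = {0,1},{1,2},{2,3},{3,4}` (the shadow of `{1,2}` inherits `(0 1)`), paw `= {0,1},{0,2},{1,2},{2,3}`
(the shadow of the pendant edge `{2,3}` inherits `(3 4)`),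
chair `= {0,1},{0,2},{0,3},{3,4}` (the shadow of `{0,3}` inherits `(3 4)`).

Honest framing.  Normalized representatives of the rigid types only (no transport / classification here, no slack type);
K1 `SideSymLaplaceOptimalFive`, `LaplaceOptimalFive` (OPEN · CONTESTED 72/120), `RankRigidMinimalRepr`, `VP ≠ VNP` NOT proved.
No definitions, no `sorry`; Mathlib + tree only.
-/

set_option linter.dupNamespace false

namespace Summit.ValiantsHypothesis.ValiantsHypothesis.Theorems.RigidityForcesSymmetryRankRigidMinimalRepr

namespace LaplaceFiveFourSplitTypes

open Finset LaplaceFiveSectorSplit LaplaceFiveThreeSplitTypes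
open LaplaceFiveTriangleSeparation (inv_mul)

/-- A fully symmetric sum of four minus a fully symmetric summand. [folklore] -/
theorem rest3_full {Y Z₁ Z₂ Z₃ : (Fin 5 → Fin 5) → ℂ} (hsum : SlotInvariantOn Finset.univ (Y + Z₁ + Z₂ + Z₃))
    (hY : SlotInvariantOn Finset.univ Y) : SlotInvariantOn Finset.univ (Z₁ + Z₂ + Z₃) := by
  intro τ hτ v
  have hs := hsum τ hτ v
  have h1 := hY τ hτ v
  simp only [Pi.add_apply] at hs ⊢
  linear_combination hs - h1

/-- **Path `P₅`** `{1,2} | {0,1}, {2,3}, {3,4}` (the first shadow sits on the inner edge `{1,2}`): four-split separation.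
[folklore] -/
theorem fourSplit_separation_path (Y Z₁ Z₂ Z₃ : (Fin 5 → Fin 5) → ℂ)
    (hY : SlotInvariantOn {1, 2} Y ∧ SlotInvariantOn {1, 2}ᶜ Y)
    (hZ₁ : SlotInvariantOn {0, 1} Z₁ ∧ SlotInvariantOn {0, 1}ᶜ Z₁)
    (hZ₂ : SlotInvariantOn {2, 3} Z₂ ∧ SlotInvariantOn {2, 3}ᶜ Z₂)
    (hZ₃ : SlotInvariantOn {3, 4} Z₃ ∧ SlotInvariantOn {3, 4}ᶜ Z₃)
    (hsum : SlotInvariantOn Finset.univ (Y + Z₁ + Z₂ + Z₃)) :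
    SlotInvariantOn Finset.univ Y ∧ SlotInvariantOn Finset.univ Z₁ ∧ SlotInvariantOn Finset.univ Z₂
      ∧ SlotInvariantOn Finset.univ Z₃ := by
  have y12 := swap_inv _ _ hY.1 (a := 1) (b := 2) (by decide) (by decide)
  have y03 := swap_inv _ _ hY.2 (a := 0) (b := 3) (by decide) (by decide)
  have y34 := swap_inv _ _ hY.2 (a := 3) (b := 4) (by decide) (by decide)
  have a01 := swap_inv _ _ hZ₁.1 (a := 0) (b := 1) (by decide) (by decide)
  have b01 := swap_inv _ _ hZ₂.2 (a := 0) (b := 1) (by decide) (by decide)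
  have c01 := swap_inv _ _ hZ₃.2 (a := 0) (b := 1) (by decide) (by decide)
  -- `(0 1)` lies in the three other Young groups
  have y01 : ∀ v : Fin 5 → Fin 5, Y (v ∘ ⇑(Equiv.swap (0 : Fin 5) 1)) = Y v := by
    intro v
    have hs := hsum (Equiv.swap 0 1) (fun i hi => absurd (Finset.mem_univ i) hi) v
    simp only [Pi.add_apply] at hs
    rw [a01 v, b01 v, c01 v] at hs
    linear_combination hs
  have y23 : ∀ v : Fin 5 → Fin 5, Y (v ∘ ⇑(Equiv.swap (2 : Fin 5) 3)) = Y v := by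
    rw [show Equiv.swap (2 : Fin 5) 3 = Equiv.swap 0 3 * (Equiv.swap 0 1 * Equiv.swap 1 2 * Equiv.swap 0 1) * Equiv.swap 0 3
      from by decide]
    exact inv_mul Y (inv_mul Y y03 (inv_mul Y (inv_mul Y y01 y12) y01)) y03
  have hYf := full_of_adjacent_swaps Y y01 y12 y23 y34
  have h3 := LaplaceFiveThreeSplit.threeSplit_separation {0, 1} {2, 3} {3, 4} (by decide) (by decide) (by decide)
    (by decide) (by decide) (by decide) Z₁ Z₂ Z₃ hZ₁ hZ₂ hZ₃ (rest3_full hsum hYf)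
  exact ⟨hYf, h3⟩

/-- **Paw** `{2,3} | {0,1}, {0,2}, {1,2}` (the first shadow sits on the pendant edge `{2,3}`): four-split separation.
[folklore] -/
theorem fourSplit_separation_paw (Y Z₁ Z₂ Z₃ : (Fin 5 → Fin 5) → ℂ)
    (hY : SlotInvariantOn {2, 3} Y ∧ SlotInvariantOn {2, 3}ᶜ Y)
    (hZ₁ : SlotInvariantOn {0, 1} Z₁ ∧ SlotInvariantOn {0, 1}ᶜ Z₁)
    (hZ₂ : SlotInvariantOn {0, 2} Z₂ ∧ SlotInvariantOn {0, 2}ᶜ Z₂)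
    (hZ₃ : SlotInvariantOn {1, 2} Z₃ ∧ SlotInvariantOn {1, 2}ᶜ Z₃)
    (hsum : SlotInvariantOn Finset.univ (Y + Z₁ + Z₂ + Z₃)) :
    SlotInvariantOn Finset.univ Y ∧ SlotInvariantOn Finset.univ Z₁ ∧ SlotInvariantOn Finset.univ Z₂
      ∧ SlotInvariantOn Finset.univ Z₃ := by
  have y23 := swap_inv _ _ hY.1 (a := 2) (b := 3) (by decide) (by decide)
  have y01 := swap_inv _ _ hY.2 (a := 0) (b := 1) (by decide) (by decide)
  have y04 := swap_inv _ _ hY.2 (a := 0) (b := 4) (by decide) (by decide)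
  have y14 := swap_inv _ _ hY.2 (a := 1) (b := 4) (by decide) (by decide)
  have a34 := swap_inv _ _ hZ₁.2 (a := 3) (b := 4) (by decide) (by decide)
  have b34 := swap_inv _ _ hZ₂.2 (a := 3) (b := 4) (by decide) (by decide)
  have c34 := swap_inv _ _ hZ₃.2 (a := 3) (b := 4) (by decide) (by decide)
  -- `(3 4)` lies in the three other Young groups
  have y34 : ∀ v : Fin 5 → Fin 5, Y (v ∘ ⇑(Equiv.swap (3 : Fin 5) 4)) = Y v := by
    intro v
    have hs := hsum (Equiv.swap 3 4) (fun i hi => absurd (Finset.mem_univ i) hi) v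
    simp only [Pi.add_apply] at hs
    rw [a34 v, b34 v, c34 v] at hs
    linear_combination hs
  have y12 : ∀ v : Fin 5 → Fin 5, Y (v ∘ ⇑(Equiv.swap (1 : Fin 5) 2)) = Y v := by
    rw [show Equiv.swap (1 : Fin 5) 2 = Equiv.swap 1 4 * (Equiv.swap 3 4 * Equiv.swap 2 3 * Equiv.swap 3 4) * Equiv.swap 1 4
      from by decide]
    exact inv_mul Y (inv_mul Y y14 (inv_mul Y (inv_mul Y y34 y23) y34)) y14
  have hYf := full_of_adjacent_swaps Y y01 y12 y23 y34
  have h3 := LaplaceFiveThreeSplit.threeSplit_separation {0, 1} {0, 2} {1, 2} (by decide) (by decide) (by decide)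
    (by decide) (by decide) (by decide) Z₁ Z₂ Z₃ hZ₁ hZ₂ hZ₃ (rest3_full hsum hYf)
  exact ⟨hYf, h3⟩

/-- **Chair** `{0,3} | {0,1}, {0,2}, {3,4}` (the first shadow sits on the subdivided edge `{0,3}`): four-split separation.
[folklore] -/
theorem fourSplit_separation_chair (Y Z₁ Z₂ Z₃ : (Fin 5 → Fin 5) → ℂ)
    (hY : SlotInvariantOn {0, 3} Y ∧ SlotInvariantOn {0, 3}ᶜ Y)
    (hZ₁ : SlotInvariantOn {0, 1} Z₁ ∧ SlotInvariantOn {0, 1}ᶜ Z₁)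
    (hZ₂ : SlotInvariantOn {0, 2} Z₂ ∧ SlotInvariantOn {0, 2}ᶜ Z₂)
    (hZ₃ : SlotInvariantOn {3, 4} Z₃ ∧ SlotInvariantOn {3, 4}ᶜ Z₃)
    (hsum : SlotInvariantOn Finset.univ (Y + Z₁ + Z₂ + Z₃)) :
    SlotInvariantOn Finset.univ Y ∧ SlotInvariantOn Finset.univ Z₁ ∧ SlotInvariantOn Finset.univ Z₂
      ∧ SlotInvariantOn Finset.univ Z₃ := by
  have y03 := swap_inv _ _ hY.1 (a := 0) (b := 3) (by decide) (by decide)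
  have y12 := swap_inv _ _ hY.2 (a := 1) (b := 2) (by decide) (by decide)
  have y14 := swap_inv _ _ hY.2 (a := 1) (b := 4) (by decide) (by decide)
  have y24 := swap_inv _ _ hY.2 (a := 2) (b := 4) (by decide) (by decide)
  have a34 := swap_inv _ _ hZ₁.2 (a := 3) (b := 4) (by decide) (by decide)
  have b34 := swap_inv _ _ hZ₂.2 (a := 3) (b := 4) (by decide) (by decide)
  have c34 := swap_inv _ _ hZ₃.1 (a := 3) (b := 4) (by decide) (by decide)
  -- `(3 4)` lies in the three other Young groups
  have y34 : ∀ v : Fin 5 → Fin 5, Y (v ∘ ⇑(Equiv.swap (3 : Fin 5) 4)) = Y v := by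
    intro v
    have hs := hsum (Equiv.swap 3 4) (fun i hi => absurd (Finset.mem_univ i) hi) v
    simp only [Pi.add_apply] at hs
    rw [a34 v, b34 v, c34 v] at hs
    linear_combination hs
  have y01 : ∀ v : Fin 5 → Fin 5, Y (v ∘ ⇑(Equiv.swap (0 : Fin 5) 1)) = Y v := by
    rw [show Equiv.swap (0 : Fin 5) 1 = Equiv.swap 1 4 * (Equiv.swap 3 4 * Equiv.swap 0 3 * Equiv.swap 3 4) * Equiv.swap 1 4
      from by decide]
    exact inv_mul Y (inv_mul Y y14 (inv_mul Y (inv_mul Y y34 y03) y34)) y14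
  have y23 : ∀ v : Fin 5 → Fin 5, Y (v ∘ ⇑(Equiv.swap (2 : Fin 5) 3)) = Y v := by
    rw [show Equiv.swap (2 : Fin 5) 3 = Equiv.swap 2 4 * Equiv.swap 3 4 * Equiv.swap 2 4 from by decide]
    exact inv_mul Y (inv_mul Y y24 y34) y24
  have hYf := full_of_adjacent_swaps Y y01 y12 y23 y34
  have h3 := LaplaceFiveThreeSplit.threeSplit_separation {0, 1} {0, 2} {3, 4} (by decide) (by decide) (by decide)
    (by decide) (by decide) (by decide) Z₁ Z₂ Z₃ hZ₁ hZ₂ hZ₃ (rest3_full hsum hYf)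
  exact ⟨hYf, h3⟩

end LaplaceFiveFourSplitTypes

end Summit.ValiantsHypothesis.ValiantsHypothesis.Theorems.RigidityForcesSymmetryRankRigidMinimalRepr
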